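import Summits.ResolutionOfSingularities.ResolutionOfSingularities.Theorems.FrobeniusClosingPatchingRelPerfectCuspLineStepCharts
import HarnessLib

/-!
# Crux `PatchingRelPerfect` (stmt-ResolutionOfSingularities-16161), chain w52 — kernel (iii)
# certificate of the cusp member, part 1c: persistence to the `a`-chart and the LINE TOWER

[OURS · L1 W5.2 · kernel (iii) certificate, CHAIN v1.7 §1 (C) «cusp (x₃²+x₀³)+𝔪⁴»] The hand route
of this seat's note `NONGRADED-CUSP-MEMBER.md` (evidence #52 on the crux item) for the simplest
NON-GRADED member `I = (x₃² + x₀³) + 𝔪⁴` of the `𝔪`-primary stratum of the open core reaches, on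
the `y`-charts of `Bl_𝔪`, the residual `K₃ = (c² + t a³) + (t²)` (`t` the exceptional
coordinate, `a = x₀/y`, `c = x₃/y`), of order `2` exactly along the LINE `V(t, a, c)`; blowing up
that line drops the exceptional exponent of the `t`-coefficient by one (`a`-chart:
`K_k ↦ a² · K_{k-1}`, the other two charts are Cartier), and after `k` line steps the residual
`K₀ = (t + c²) + (t²)` is the TANGENT EUCLID datum of `…TangentEuclidExplicit.lean` (p508825).
The LINE-STEP INDUCTION is proved at ring level, with the S-avatars of the note carried along as
residual factors (so that one global companion serves every chart):

  `F_k(t, c, a) = ∏_{1 ≤ j ≤ k} (t, aʲ, c) · [ ((c² + t aᵏ) + (t²)) · ( (c², t aᵏ, t²) ·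
                  ((c² + t aᵏ) + (t², t c)) ) · (t, c) ]`

This file (part 1c of 3):

* `CuspMember.lineHyp_aChart` — PERSISTENCE of the hypotheses to the `a`-chart `B`: `(t/a, c/a, a)`
  is weakly regular with `B/(t/a, c/a, a)` and `B/(t/a, c/a)` regular — by the chart family of
  `…CoreRungTowerCharts.lean` and the strict transform of the coordinate subspace
  `V(t, c) ⊇ V(t, c, a)` (`ChartStrictTransform`, p512186: `B/(t′, c′) ≅` the chart ring of
  `Bl_{(ā)} Spec R/(t, c)`);
* `CuspMember.lineTower_isRegular` — **P(k)**: for every regular ring `R` and `t, c, a ∈ R` with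
  `(t, c, a)` weakly regular, `R/(t, c, a)` and `R/(t, c)` regular rings, every blowing up of
  `Spec R` along `F_k(t, c, a)` is a regular scheme (induction on `k`; `P(0)` =
  `CoreRungTower.tangent_euclid_two_two`, p508825).

Every regular ring, no dimension / characteristic / residue-field hypothesis.  Part 2 assembles the
member over a regular local ring.  FORMAT evidence for the core on the `𝔪`-primary stratum
(CHAIN §1 (C)); nothing here is a statement of the manuscript under review.

## References

* Q. Liu, *Algebraic Geometry and Arithmetic Curves*, OUP 2002, Thm. 8.1.19 (a). [Liu2002]
* The Stacks Project, Tags 080A, 080B, 0804, 0BIQ. [StacksProject]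
* U. Görtz, T. Wedhorn, *Algebraic Geometry I* (2nd ed., 2020), Prop. 13.96 (2). [GortzWedhorn2020]
* H. Matsumura, *Commutative Ring Theory*, CUP 1986, Thm. 16.2 (i). [Matsumura1987]
-/

-- `Summit.<Summit>.<Sub>.Theorems` with `Sub = Summit` (single-conjunct summit, D-0017)
set_option linter.dupNamespace false

noncomputable section

open CategoryTheory CategoryTheory.Limits AlgebraicGeometry Literature.AlgebraicGeometry.Resolution
open scoped Pointwise nonZeroDivisors

namespace Summit.ResolutionOfSingularities.ResolutionOfSingularities.Theorems

universe u

namespace CuspMember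

/-! ## Notation: the residual factors of the line steps -/

/-- Line avatar `(t, aʲ⁺¹, c)`. -/
local notation3 "Lf[" t "," c "," a "," j "]" =>
  (Ideal.span {t} ⊔ Ideal.span {a ^ (j + 1)} ⊔ Ideal.span {c})
/-- The residual `K_k = (c² + t aᵏ) + (t²)` of the member itself. -/
local notation3 "Kf[" t "," c "," a "," k "]" => (Ideal.span {c ^ 2 + t * a ^ k} ⊔ Ideal.span {t ^ 2})
/-- The residual of the graded-hull avatar `J`: `(c², t aᵏ, t²)`. -/
local notation3 "Jf[" t "," c "," a "," k "]" =>
  (Ideal.span {c ^ 2} ⊔ Ideal.span {t * a ^ k} ⊔ Ideal.span {t ^ 2})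
/-- The residual of the avatar `I + x₃𝔪²`: `(c² + t aᵏ) + (t², t c)`. -/
local notation3 "Af[" t "," c "," a "," k "]" =>
  ((Ideal.span {c ^ 2 + t * a ^ k} ⊔ Ideal.span {t ^ 2}) ⊔ Ideal.span {t * c})
/-- The tangency locus `(t, c)`. -/
local notation3 "Sf[" t "," c "]" => Ideal.span (Set.range ![t, c])
/-- The tangent-Euclid block `K · (J · A) · (t, c)`. -/
local notation3 "Tf[" t "," c "," a "," k "]" =>
  (Kf[t,c,a,k] * (Jf[t,c,a,k] * Af[t,c,a,k]) * Sf[t,c])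
/-- The full residual `F_k = ∏_{j<k} (t, aʲ⁺¹, c) · T_k`. -/
local notation3 "Ff[" t "," c "," a "," k "]" =>
  ((∏ j ∈ Finset.range k, Lf[t,c,a,j]) * Tf[t,c,a,k])
/-- The tail `G_k` of `F_{k+1}` after peeling off the centre `(t, a, c)`. -/
local notation3 "Gf[" t "," c "," a "," k "]" =>
  ((∏ j ∈ Finset.range k, Lf[t,c,a,j + 1]) * Tf[t,c,a,k + 1])


/-! ## Persistence of the hypotheses to the `a`-chart -/

section Persistence

variable {R : Type u} [CommRing R] (t c a : R)

local notation3 "xx" => (![t, c, a] : Fin 3 → R)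
/-- `J = {t, c}`: the complement `{a}` is indexed by `Fin 1`. -/
local notation3 "emb₁" => (fun _ : Fin 1 => (2 : Fin 3))
/-- `J = {t, c}` as a sub-family of the indices `≠ 2`. -/
local notation3 "jJ₁" =>
  (![⟨0, of_decide_eq_true rfl⟩, ⟨1, of_decide_eq_true rfl⟩] : Fin 2 → {j : Fin 3 // j ≠ emb₁ 0})
/-- `J = {t}`: the complement `{c, a}` is indexed by `Fin 2`. -/
local notation3 "emb₂" => (![(1 : Fin 3), 2] : Fin 2 → Fin 3)
/-- `J = {t}` as a sub-family of the indices `≠ 2`. -/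
local notation3 "jJ₂" => (fun _ : Fin 1 => (⟨0, of_decide_eq_true rfl⟩ : {j : Fin 3 // j ≠ emb₂ 1}))

/-- The base ideal of `jJ₁` is `(t, c)`. [folklore] -/
theorem Q₁_eq : Ideal.span (Set.range fun k : Fin 2 => xx (jJ₁ k).1) = Ideal.span {t} ⊔ Ideal.span {c} := by
  have : (fun k : Fin 2 => xx (jJ₁ k).1) = ![t, c] := by funext k; fin_cases k <;> rfl
  rw [this, span_range_vec2]

/-- The exceptional ideal of `jJ₁` is `(t′, c′)`. [folklore] -/
theorem EJ₁_eq : Ideal.span (Set.range fun k : Fin 2 => chartGen xx (emb₁ 0) (jJ₁ k).1) =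
    Ideal.span {chartGen xx 2 0} ⊔ Ideal.span {chartGen xx 2 1} := by
  have : (fun k : Fin 2 => chartGen xx (emb₁ 0) (jJ₁ k).1) = ![chartGen xx 2 0, chartGen xx 2 1] := by
    funext k; fin_cases k <;> rfl
  rw [this, span_range_vec2]

/-- The base ideal of `jJ₂` is `(t)`. [folklore] -/
theorem Q₂_eq : Ideal.span (Set.range fun k : Fin 1 => xx (jJ₂ k).1) = Ideal.span {t} := by
  have : (fun k : Fin 1 => xx (jJ₂ k).1) = fun _ => t := by funext k; rfl
  rw [this, Set.range_const]

/-- The exceptional ideal of `jJ₂` is `(t′)`. [folklore] -/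
theorem EJ₂_eq : Ideal.span (Set.range fun k : Fin 1 => chartGen xx (emb₂ 1) (jJ₂ k).1) =
    Ideal.span {chartGen xx 2 0} := by
  have : (fun k : Fin 1 => chartGen xx (emb₂ 1) (jJ₂ k).1) = fun _ => chartGen xx 2 0 := by
    funext k; rfl
  rw [this, Set.range_const]
  rfl

/-- `jJ₁` and `emb₁` cover all indices. [folklore] -/
theorem cov₁ : ∀ j : Fin 3, (∃ k, emb₁ k = j) ∨ ∃ k, (jJ₁ k).1 = j := by decide

/-- `jJ₂` and `emb₂` cover all indices. [folklore] -/
theorem cov₂ : ∀ j : Fin 3, (∃ k, emb₂ k = j) ∨ ∃ k, (jJ₂ k).1 = j := by decide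

/-- `ā` is a non-zero-divisor of `R/(t, c)` (in the `jJ₁` presentation). [folklore] -/
theorem mk_a_mem_nonZeroDivisors (hw : RingTheory.Sequence.IsWeaklyRegular R [t, c, a]) :
    Ideal.Quotient.mk (Ideal.span (Set.range fun k : Fin 2 => xx (jJ₁ k).1)) a ∈
      (R ⧸ Ideal.span (Set.range fun k : Fin 2 => xx (jJ₁ k).1))⁰ := by
  refine mk_mem_nonZeroDivisors_of_forall fun g hg => ?_
  rw [Q₁_eq] at hg ⊢
  exact forall_mem_of_isWeaklyRegular₃ hw g hg

/-- `c̄` is a non-zero-divisor of `R/(t)` (in the `jJ₂` presentation). [folklore] -/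
theorem mk_c_mem_nonZeroDivisors (hw : RingTheory.Sequence.IsWeaklyRegular R [t, c, a]) :
    Ideal.Quotient.mk (Ideal.span (Set.range fun k : Fin 1 => xx (jJ₂ k).1)) c ∈
      (R ⧸ Ideal.span (Set.range fun k : Fin 1 => xx (jJ₂ k).1))⁰ := by
  refine mk_mem_nonZeroDivisors_of_forall fun g hg => ?_
  rw [Q₂_eq] at hg ⊢
  exact forall_mem_of_isWeaklyRegular₂ hw g hg

/-- **PERSISTENCE.** For `R` regular and `(t, c, a)` weakly regular with `R/(t, c, a)` and
`R/(t, c)` regular, the `a`-chart `B = B_a` of `Bl_{(t,c,a)} Spec R` is regular, its family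
`(t′, c′, a) = (t/a, c/a, a/1)` is weakly regular, and `B/(t′, c′, a)`, `B/(t′, c′)` are regular
rings (the last two by the chart family of `…CoreRungTowerCharts.lean` and by the strict
transform of `V(t, c)`, `ChartStrictTransform.isRegularRing_quotient_span_chartGen`).
[cite: GortzWedhorn2020, Prop. 13.96 (2)] [cite: StacksProject, Tag 0BIQ] [cite: Liu2002, Thm. 8.1.19 (a)] -/
theorem lineHyp_aChart [IsRegularRing R] (hw : RingTheory.Sequence.IsWeaklyRegular R [t, c, a])
    (h3 : IsRegularRing (R ⧸ (Ideal.span {t} ⊔ Ideal.span {c} ⊔ Ideal.span {a})))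
    (h2 : IsRegularRing (R ⧸ (Ideal.span {t} ⊔ Ideal.span {c}))) :
    IsRegularRing (chartRing xx 2) ∧
    RingTheory.Sequence.IsWeaklyRegular (chartRing xx 2)
      [chartGen xx 2 0, chartGen xx 2 1, chartBase xx 2 a] ∧
    IsRegularRing (chartRing xx 2 ⧸ (Ideal.span {chartGen xx 2 0} ⊔ Ideal.span {chartGen xx 2 1} ⊔
      Ideal.span {chartBase xx 2 a})) ∧
    IsRegularRing (chartRing xx 2 ⧸ (Ideal.span {chartGen xx 2 0} ⊔ Ideal.span {chartGen xx 2 1})) := by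
  have hx : IsQuasiRegular xx := isQuasiRegular_vec3 hw
  have cb_t_two : chartBase xx 2 t = chartBase xx 2 a * chartGen xx 2 0 :=
    reesChartBase_apply_eq_mul_chartGen xx 2 0
  have cb_c_two : chartBase xx 2 c = chartBase xx 2 a * chartGen xx 2 1 :=
    reesChartBase_apply_eq_mul_chartGen xx 2 1
  haveI hRx : IsRegularRing (R ⧸ Ideal.span (Set.range xx)) := by rw [span_range_vec3]; exact h3
  have hjJ₁ : Function.Injective jJ₁ := by decide
  have hjJ₂ : Function.Injective jJ₂ := fun i j _ => Subsingleton.elim i j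
  -- `B` is regular
  have hB : IsRegularRing (chartRing xx 2) := isRegularRing_blowupChart xx 2 hx
  -- `B/(t′, c′)` is regular: strict transform of `V(t, c)`
  have h2' : IsRegularRing (chartRing xx 2 ⧸ (Ideal.span {chartGen xx 2 0} ⊔ Ideal.span {chartGen xx 2 1})) := by
    have hRQ : IsRegularRing (R ⧸ Ideal.span (Set.range fun k : Fin 2 => xx (jJ₁ k).1)) := by
      rw [Q₁_eq]; exact h2
    have ha := mk_a_mem_nonZeroDivisors t c a hw
    have hxb : IsQuasiRegular (fun k : Fin 1 => Ideal.Quotient.mk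
        (Ideal.span (Set.range fun k : Fin 2 => xx (jJ₁ k).1)) (xx (emb₁ k))) := by
      refine isQuasiRegular_of_isWeaklyRegular _ ?_
      exact (RingTheory.Sequence.isWeaklyRegular_singleton_iff _ _).mpr
        (Module.Flat.isSMulRegular_of_nonZeroDivisors ha)
    have hRI : IsRegularRing ((R ⧸ Ideal.span (Set.range fun k : Fin 2 => xx (jJ₁ k).1)) ⧸
        Ideal.span (Set.range fun k : Fin 1 => Ideal.Quotient.mk
          (Ideal.span (Set.range fun k : Fin 2 => xx (jJ₁ k).1)) (xx (emb₁ k)))) := by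
      have hr : Ideal.span (Set.range fun k : Fin 1 => Ideal.Quotient.mk
          (Ideal.span (Set.range fun k : Fin 2 => xx (jJ₁ k).1)) (xx (emb₁ k))) =
          (Ideal.span {a}).map (Ideal.Quotient.mk (Ideal.span (Set.range fun k : Fin 2 => xx (jJ₁ k).1))) := by
        rw [map_span_singleton, Set.range_const]; rfl
      rw [hr]
      have e := DoubleQuot.quotQuotEquivQuotSup (Ideal.span (Set.range fun k : Fin 2 => xx (jJ₁ k).1))
        (Ideal.span {a})
      have f : R ⧸ (Ideal.span (Set.range fun k : Fin 2 => xx (jJ₁ k).1) ⊔ Ideal.span {a}) ≃+*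
          R ⧸ (Ideal.span {t} ⊔ Ideal.span {c} ⊔ Ideal.span {a}) := Ideal.quotEquivOfEq (by rw [Q₁_eq])
      haveI := h3
      exact IsRegularRing.of_ringEquiv (e.trans f).symm
    have h := ChartStrictTransform.isRegularRing_quotient_span_chartGen xx emb₁ 0 jJ₁ hx hjJ₁ cov₁
      hRQ hxb hRI
    rw [EJ₁_eq] at h
    exact h
  -- `B/(t′, c′, a)` is regular: the chart family
  have h3' : IsRegularRing (chartRing xx 2 ⧸ (Ideal.span {chartGen xx 2 0} ⊔ Ideal.span {chartGen xx 2 1} ⊔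
      Ideal.span {chartBase xx 2 a})) := by
    have h := CoreRungTower.isRegularRing_quot_chartFamily xx 2 jJ₁ hx
    have hr : Ideal.span (Set.range (Fin.cons (chartBase xx 2 (xx 2)) fun k => chartGen xx 2 (jJ₁ k).1)) =
        Ideal.span {chartGen xx 2 0} ⊔ Ideal.span {chartGen xx 2 1} ⊔ Ideal.span {chartBase xx 2 a} := by
      rw [Fin.range_cons, Ideal.span_insert, EJ₁_eq, sup_comm]
      rfl
    rw [hr] at h
    exact h
  -- `(t′, c′, a)` is weakly regular
  have hw' : RingTheory.Sequence.IsWeaklyRegular (chartRing xx 2)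
      [chartGen xx 2 0, chartGen xx 2 1, chartBase xx 2 a] := by
    refine isWeaklyRegular_three ?_ ?_ ?_
    · -- `t′ ∣ t/1`, a non-zero-divisor
      have ht : chartBase xx 2 t ∈ (chartRing xx 2)⁰ :=
        reesChartBase_mem_nonZeroDivisors_of_mem_nonZeroDivisors (I := Ideal.span (Set.range xx)) (xx 2)
          (Ideal.mem_span_range_self (f := xx) (x := 2)) (nzd_of_isWeaklyRegular₁ hw)
      rw [cb_t_two] at ht
      exact mem_nonZeroDivisors_of_mul_mem ht
    · -- `c′` is regular modulo `(t′)`: strict transform of `V(t)`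
      have h := ChartStrictTransform.mk_chartBase_mem_nonZeroDivisors xx emb₂ 1 jJ₂ hx hjJ₂ cov₂
        (mk_c_mem_nonZeroDivisors t c a hw)
      rw [EJ₂_eq] at h
      have h' : Ideal.Quotient.mk (Ideal.span {chartGen xx 2 0}) (chartBase xx 2 c) ∈
          (chartRing xx 2 ⧸ Ideal.span {chartGen xx 2 0})⁰ := h
      rw [cb_c_two, map_mul] at h'
      exact forall_mem_of_mk_mem_nonZeroDivisors (mem_nonZeroDivisors_of_mul_mem h')
    · -- `a/1` is regular modulo `(t′, c′)`: strict transform of `V(t, c)`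
      have h := ChartStrictTransform.mk_chartBase_mem_nonZeroDivisors xx emb₁ 0 jJ₁ hx hjJ₁ cov₁
        (mk_a_mem_nonZeroDivisors t c a hw)
      rw [EJ₁_eq] at h
      exact forall_mem_of_mk_mem_nonZeroDivisors h
  exact ⟨hB, hw', h3', h2'⟩

end Persistence

/-! ## The line-step induction -/

/-- **THE LINE TOWER (P(k), ring level).** For every `k`, every regular ring `R` and
`t, c, a ∈ R` such that `(t, c, a)` is a weakly regular sequence and `R/(t, c, a)`, `R/(t, c)` are
regular rings, every blowing up of `Spec R` along
`F_k = ∏_{1≤j≤k} (t, aʲ, c) · ((c² + t aᵏ) + (t²)) · (c², t aᵏ, t²) · ((c² + t aᵏ) + (t², tc)) · (t, c)`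
is a regular scheme.  `k = 0`: tangent Euclid (`CoreRungTower.tangent_euclid_two_two`, p508825).
`k + 1`: blow up the line `V(t, a, c)`; the `t`- and `c`-charts are Cartier (`map_G_zero`,
`map_G_one`), the `a`-chart is `a^N · F_k(t/a, c/a, a)` (`map_G_two`) with the hypotheses
persisting (`lineHyp_aChart`).  Geometrically (cusp member, `y`-charts of `Bl_𝔪`): the `k` line
blow-ups `ℓ, ℓ₂, …` of the note, then the tangent-Euclid finish.
[cite: Liu2002, Thm. 8.1.19 (a)] [cite: StacksProject, Tag 080A] [cite: GortzWedhorn2020, Prop. 13.96 (2)] -/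
theorem lineTower_isRegular (k : ℕ) :
    ∀ {R : Type u} [CommRing R] [IsRegularRing R] (t c a : R),
      RingTheory.Sequence.IsWeaklyRegular R [t, c, a] →
      IsRegularRing (R ⧸ (Ideal.span {t} ⊔ Ideal.span {c} ⊔ Ideal.span {a})) →
      IsRegularRing (R ⧸ (Ideal.span {t} ⊔ Ideal.span {c})) →
      ∀ {Y : Scheme.{u}} {f : Y ⟶ Spec (.of R)},
        IsBlowup f (affineBlowup.idealSheaf (Ff[t,c,a,k])) → Scheme.IsRegular Y := by
  induction k with
  | zero =>
    intro R _ _ t c a hw h3 h2 Y f hf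
    rw [F_zero] at hf
    have h2' : IsRegularRing (R ⧸ Ideal.span (Set.range (![t, c] : Fin 2 → R))) := by
      rw [span_range_vec2]; exact h2
    exact CoreRungTower.tangent_euclid_two_two t c (isQuasiRegular_vec2 hw) h2' hf
  | succ k ih =>
    intro R _ _ t c a hw h3 h2 Y f hf
    rw [F_succ] at hf
    have hx : IsQuasiRegular (![t, c, a] : Fin 3 → R) := isQuasiRegular_vec3 hw
    haveI hRx : IsRegularRing (R ⧸ Ideal.span (Set.range (![t, c, a] : Fin 3 → R))) := by
      rw [span_range_vec3]; exact h3
    refine isRegular_of_isBlowup_mul_of_charts (![t, c, a] : Fin 3 → R) _ (fun i Y' ρ hρ => ?_) hf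
    haveI hB : IsRegularRing (chartRing (![t, c, a] : Fin 3 → R) i) := isRegularRing_blowupChart _ i hx
    have hi : i = 0 ∨ i = 1 ∨ i = 2 := by
      fin_cases i
      · exact Or.inl rfl
      · exact Or.inr (Or.inl rfl)
      · exact Or.inr (Or.inr rfl)
    rcases hi with rfl | rfl | rfl
    · -- `t`-chart: Cartier
      rw [map_G_zero] at hρ
      have ht : chartBase (![t, c, a] : Fin 3 → R) 0 t ∈ (chartRing (![t, c, a] : Fin 3 → R) 0)⁰ :=
        reesChartBase_mem_nonZeroDivisors ((![t, c, a] : Fin 3 → R) 0)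
          (Ideal.mem_span_range_self (f := (![t, c, a] : Fin 3 → R)) (x := 0))
      exact isRegular_of_isBlowup_span_singleton_nzd
        (mul_mem (pow_mem ht k) (mul_mem (mul_mem (pow_mem ht 2) (mul_mem (pow_mem ht 2) (pow_mem ht 2))) ht)) hρ
    · -- `c`-chart: Cartier
      rw [map_G_one] at hρ
      have hc : chartBase (![t, c, a] : Fin 3 → R) 1 c ∈ (chartRing (![t, c, a] : Fin 3 → R) 1)⁰ :=
        reesChartBase_mem_nonZeroDivisors ((![t, c, a] : Fin 3 → R) 1)
          (Ideal.mem_span_range_self (f := (![t, c, a] : Fin 3 → R)) (x := 1))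
      exact isRegular_of_isBlowup_span_singleton_nzd
        (mul_mem (pow_mem hc k) (mul_mem (mul_mem (pow_mem hc 2) (mul_mem (pow_mem hc 2) (pow_mem hc 2))) hc)) hρ
    · -- `a`-chart: twist off `a^N` and descend
      rw [map_G_two] at hρ
      have ha : chartBase (![t, c, a] : Fin 3 → R) 2 a ∈ (chartRing (![t, c, a] : Fin 3 → R) 2)⁰ :=
        reesChartBase_mem_nonZeroDivisors ((![t, c, a] : Fin 3 → R) 2)
          (Ideal.mem_span_range_self (f := (![t, c, a] : Fin 3 → R)) (x := 2))
      obtain ⟨-, hw', h3', h2'⟩ := lineHyp_aChart t c a hw h3 h2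
      refine CoreRungTower.isRegular_of_isBlowup_span_singleton_mul
        (mul_mem (pow_mem ha k) (mul_mem (mul_mem (pow_mem ha 2) (mul_mem (pow_mem ha 2) (pow_mem ha 2))) ha))
        _ (fun Y'' ρ' hρ' => ?_) hρ
      exact ih _ _ _ hw' h3' h2' hρ'


end CuspMember

end Summit.ResolutionOfSingularities.ResolutionOfSingularities.Theorems

end
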